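import Summits.AtomisticToContinuum.FouriersLaw.Theorems.EmbeddedDrudeMourreMourreDissolutionGibbsMixing
import Literature.MathematicalPhysics.KineticTheory.TransportRegularityOfMixing
import Literature.MathematicalPhysics.KineticTheory.InfiniteChainClusteringTransfer
import Literature.MathematicalPhysics.KineticTheory.InfiniteChainL2Locality
import Literature.MathematicalPhysics.KineticTheory.InfiniteChainGeneratorLipschitz
import Literature.MathematicalPhysics.KineticTheory.InfiniteChainTwoPointContinuity
import Literature.MathematicalPhysics.KineticTheory.InfiniteChainSeveredGibbs
import Literature.MathematicalPhysics.KineticTheory.InfiniteChainGibbsInvariance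
import HarnessLib

/-!
# `EmbeddedDrudeMourre.MourreDissolution`, line `separable-vertex-faddeev-pair-sector` —
# registered stub S1′ `stub_gibbsClustering`: a regular Gibbs state of the pinned anharmonic
# chain with space–time `ℓ¹`-clustering of the generators along the Buttà–Marchioro flow

Item `stmt-AtomisticToContinuum-12594` (crux `MourreDissolution` of route `EmbeddedDrudeMourre`,
sub-problem `FouriersLaw`). The registered stub asks, for `pinnedChain ω₂ lam β γ`
(`ω₂, lam, β > 0`), every `T > 0` and the canonical Buttà–Marchioro dynamics `D` (carrier `𝒳₀`,
measurable flow, identity off `𝒳₀`), for ONE measure `μ` on `ℤ → ℝ × ℝ` which is a DLR Gibbs state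
at `T`, shift invariant, superstable, reflection invariant, with `x ↦ Cov_μ(a, (b ∘ τ_x) ∘ φ_u)`
summable for `a, b ∈ {j₀, h₀}` and every `u`, and `t ↦ Σ_x Cov_μ(a, (a ∘ τ_x) ∘ φ_t)` continuous
at `0`.

This file is the ASSEMBLY; every analytic input is a proved tree theorem:

* the state — `exists_gibbsState_mixing_pinnedChain` (sibling file `…GibbsMixing`): the
  transfer-operator Markov state, DLR + shift invariant + superstable + reflection invariant +
  exponentially `ρ`-mixing between half-lines (input (M));
* invariance of `μ` under `D` — `OscillatorChain.preservesMeasure_of_carrier_eq_bmGood`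
  (`InfiniteChainGibbsInvariance`), and under the severed box flows —
  `OscillatorChain.measurePreserving_severedFlow_of_isChainGibbsMeasure` (LLL 1977 §4 (i));
* input (L), fixed-time `L²(μ)` locality of `j₀ ∘ φ_t`, `h₀ ∘ φ_t` with summable rate, uniformly on
  compact time intervals — `InfiniteChainDynamics.exists_summable_l2_locality` (BM 2016 §3 light
  cone + tail (2.6)), the generators being polynomially Lipschitz
  (`InfiniteChainGeneratorLipschitz`) with fourth moments (superstability);
* the transfer (M) + (L) ⇒ clustering — `summable_covariance_comp_chainShift_comp`
  (`InfiniteChainClusteringTransfer`) for the summability clause, and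
  `InfiniteChainDynamics.continuous_integral_count_cov_flow` (`TransportRegularityOfMixing`,
  with the two-point continuity of `InfiniteChainCorrelationContinuity` /
  `InfiniteChainTwoPointContinuity`) for the continuity clause, moved to the registered shape
  `(a ∘ τ_x) ∘ φ_t` by the commutation `φ_t ∘ τ_x = τ_x ∘ φ_t` of a dynamics which is the identity
  off `𝒳₀` (`InfiniteChainDynamics.flow_chainShift_of_eq_id`).

[cite: ButtaMarchioro2016, §2 Thm 2.1–2.2 and §3]
-/

noncomputable section

namespace Summit.AtomisticToContinuum.FouriersLaw.Theorems.MourreDissolution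

open MeasureTheory ProbabilityTheory Filter Set Function
open Literature.MathematicalPhysics.KineticTheory.HeatConduction
open scoped Topology

/-- **Stub S1′ — a regular Gibbs state with space–time clustering** (registered stub
`stub_gibbsClustering` of line separable-vertex-faddeev-pair-sector). For `pinnedChain ω₂ lam β γ`
(`ω₂, lam, β > 0`; `γ` idle), every `T > 0` and the canonical Buttà–Marchioro dynamics `D`
(carrier `bmGood`, measurable flow, identity off `bmGood`): there is a DLR Gibbs state `μ` at `T`
which is shift invariant, obeys the superstability estimate, is invariant under the spatial
reflection `σ ↦ σ(-·)`, and in which, for `a, b ∈ {j₀, h₀}`, `x ↦ Cov_μ(a, (b ∘ τ_x) ∘ φ_u)` is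
summable for every `u` and `t ↦ Σ_x Cov_μ(a, (a ∘ τ_x) ∘ φ_t)` is continuous at `0` (the
transfer-operator state of the 1-D chain; exponential mixing + fixed-time `L²` locality of the
superstable flow ⇒ `ℓ¹` clustering; continuity by locally uniform domination).
[cite: ButtaMarchioro2016, §2 Thm 2.1–2.2 and §3] -/
theorem stub_gibbsClustering :
    ∀ ω₂ lam β γ : ℝ, 0 < ω₂ → 0 < lam → 0 < β → ∀ T : ℝ, 0 < T →
      ∀ D : Literature.MathematicalPhysics.KineticTheory.HeatConduction.InfiniteChainDynamics (Literature.MathematicalPhysics.KineticTheory.HeatConduction.pinnedChain ω₂ lam β γ),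
        D.carrier = (Literature.MathematicalPhysics.KineticTheory.HeatConduction.pinnedChain ω₂ lam β γ).bmGood → (∀ t : ℝ, Measurable (D.flow t)) →
        (∀ t : ℝ, ∀ σ ∉ (Literature.MathematicalPhysics.KineticTheory.HeatConduction.pinnedChain ω₂ lam β γ).bmGood, D.flow t σ = σ) →
        ∃ μ : MeasureTheory.Measure (ℤ → ℝ × ℝ),
          (Literature.MathematicalPhysics.KineticTheory.HeatConduction.pinnedChain ω₂ lam β γ).IsChainGibbsMeasure T μ ∧ Literature.MathematicalPhysics.KineticTheory.HeatConduction.IsShiftInvariant μ ∧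
          (Literature.MathematicalPhysics.KineticTheory.HeatConduction.pinnedChain ω₂ lam β γ).HasSuperstabilityEstimate μ ∧
          μ.map (fun (σ : ℤ → ℝ × ℝ) (x : ℤ) => σ (-x)) = μ ∧
          (∀ a ∈ ({fun σ => (Literature.MathematicalPhysics.KineticTheory.HeatConduction.pinnedChain ω₂ lam β γ).bondCurrentZ σ 0,
              fun σ => (Literature.MathematicalPhysics.KineticTheory.HeatConduction.pinnedChain ω₂ lam β γ).energyDensityZ σ 0} : Set ((ℤ → ℝ × ℝ) → ℝ)),
            ∀ b ∈ ({fun σ => (Literature.MathematicalPhysics.KineticTheory.HeatConduction.pinnedChain ω₂ lam β γ).bondCurrentZ σ 0,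
              fun σ => (Literature.MathematicalPhysics.KineticTheory.HeatConduction.pinnedChain ω₂ lam β γ).energyDensityZ σ 0} : Set ((ℤ → ℝ × ℝ) → ℝ)),
            ∀ u : ℝ, Summable fun x : ℤ =>
              ProbabilityTheory.covariance a ((b ∘ Literature.MathematicalPhysics.KineticTheory.HeatConduction.chainShift x) ∘ D.flow u) μ) ∧
          (∀ a ∈ ({fun σ => (Literature.MathematicalPhysics.KineticTheory.HeatConduction.pinnedChain ω₂ lam β γ).bondCurrentZ σ 0,
              fun σ => (Literature.MathematicalPhysics.KineticTheory.HeatConduction.pinnedChain ω₂ lam β γ).energyDensityZ σ 0} : Set ((ℤ → ℝ × ℝ) → ℝ)),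
            ContinuousAt (fun t : ℝ => ∑' x : ℤ,
              ProbabilityTheory.covariance a ((a ∘ Literature.MathematicalPhysics.KineticTheory.HeatConduction.chainShift x) ∘ D.flow t) μ) 0) := by
  intro ω₂ lam β γ hω hl hβ T hT D hcar hmeas hid
  -- the chain data: `U`, `V` even non-negative quartic polynomials, `C²`, condition B1
  have hU1 : OscillatorChain.IsEvenPolyOfDegree (pinnedChain ω₂ lam β γ).U 2 :=
    OscillatorChain.pinnedChain_isEvenPolyOfDegree_U β γ hω.le hl
  have hV1 : OscillatorChain.IsEvenPolyOfDegree (pinnedChain ω₂ lam β γ).V 2 :=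
    OscillatorChain.pinnedChain_isEvenPolyOfDegree_V ω₂ lam γ hβ
  have hU0 : ∀ r, 0 ≤ (pinnedChain ω₂ lam β γ).U r :=
    OscillatorChain.pinnedChain_U_nonneg β γ hω.le hl.le
  have hV0 : ∀ r, 0 ≤ (pinnedChain ω₂ lam β γ).V r := hV1.choose_spec.2.2
  have hU : ContDiff ℝ 2 (pinnedChain ω₂ lam β γ).U := hU1.contDiff_two
  have hV : ContDiff ℝ 2 (pinnedChain ω₂ lam β γ).V := hV1.contDiff_two
  have hUc : Continuous (pinnedChain ω₂ lam β γ).U := hU.continuous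
  have hUm : Measurable (pinnedChain ω₂ lam β γ).U := hU.continuous.measurable
  have hVm : Measurable (pinnedChain ω₂ lam β γ).V := hV.continuous.measurable
  have hB1 : (pinnedChain ω₂ lam β γ).CondB1 :=
    OscillatorChain.condB1_of_bddBelow _ hU hV ⟨0, by rintro _ ⟨q, rfl⟩; exact hU0 q⟩
      ⟨0, by rintro _ ⟨r, rfl⟩; exact hV0 r⟩
  -- the state: DLR, shift invariant, superstable, reflection invariant, exponentially mixing (M)
  obtain ⟨μ, hG, hS, hss, hrefl, C, m, hm, hmix⟩ :=
    exists_gibbsState_mixing_pinnedChain ω₂ lam β γ hω hl.le hβ.le T hT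
  haveI : IsProbabilityMeasure μ := hss.1
  -- `μ` is invariant under the flow of `D` and under the severed box flows
  have hD : D.PreservesMeasure μ :=
    OscillatorChain.preservesMeasure_of_carrier_eq_bmGood (by norm_num) (by norm_num) hU1 hV1 D
      hcar hmeas hG hss
  have hsev : ∀ (n : ℕ) (t : ℝ), MeasurePreserving
      (OscillatorChain.severedFlow hB1 (Finset.Icc ((0 : ℤ) - n) ((0 : ℤ) + n)) t) μ μ := fun n t =>
    OscillatorChain.measurePreserving_severedFlow_of_isChainGibbsMeasure hU hV hB1 _ hG t
  have hτ : ∀ x : ℤ, MeasurePreserving (chainShift x) μ μ := hS.measurePreserving_chainShift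
  -- the flow commutes with the translations everywhere
  have hφ : ∀ (t : ℝ) (x : ℤ), D.flow t ∘ chainShift x = chainShift x ∘ D.flow t := fun t x =>
    funext fun σ => D.flow_chainShift_of_eq_id hcar hid hU0 hV0 t x σ
  -- the mixing constant may be taken non-negative
  have hmix' : ∀ (a : ℤ) (n : ℕ) (f g : ChainConfig → ℝ),
      DependsOn f {i : ℤ | i ≤ a} → DependsOn g {i : ℤ | a + n ≤ i} → Measurable f → Measurable g →
      MemLp f 2 μ → MemLp g 2 μ →
      |∫ σ, f σ * g σ ∂μ - (∫ σ, f σ ∂μ) * ∫ σ, g σ ∂μ| ≤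
        max C 0 * Real.exp (-(m * n)) * (∫ σ, f σ ^ 2 ∂μ) ^ (1 / 2 : ℝ) *
          (∫ σ, g σ ^ 2 ∂μ) ^ (1 / 2 : ℝ) := by
    intro a n f g h1 h2 h3 h4 h5 h6
    refine (hmix a n f g h1 h2 h3 h4 h5 h6).trans ?_
    have hA : 0 ≤ (∫ σ, f σ ^ 2 ∂μ) ^ (1 / 2 : ℝ) :=
      Real.rpow_nonneg (integral_nonneg fun _ => sq_nonneg _) _
    have hB : 0 ≤ (∫ σ, g σ ^ 2 ∂μ) ^ (1 / 2 : ℝ) :=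
      Real.rpow_nonneg (integral_nonneg fun _ => sq_nonneg _) _
    have hE : 0 ≤ Real.exp (-(m * n)) := Real.exp_nonneg _
    have : C * Real.exp (-(m * n)) ≤ max C 0 * Real.exp (-(m * n)) :=
      mul_le_mul_of_nonneg_right (le_max_left _ _) hE
    exact mul_le_mul_of_nonneg_right (mul_le_mul_of_nonneg_right this hA) hB
  have hC : 0 ≤ max C 0 := le_max_right _ _
  -- fourth moments as integrability of fourth powers
  have hpow4 : ∀ {a : ChainConfig → ℝ}, MemLp a 4 μ → Integrable (fun σ => a σ ^ 4) μ := by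
    intro a h4
    have h := h4.integrable_norm_pow' (p := 4)
    refine h.congr (Eventually.of_forall fun σ => ?_)
    simp only [Real.norm_eq_abs]
    exact Even.pow_abs (by decide) _
  -- the generators `j₀`, `h₀`: measurable, local, square integrable, `L²`-local along the flow (L),
  -- with continuous two-point functions
  have hgen : ∀ a ∈ ({fun σ => (pinnedChain ω₂ lam β γ).bondCurrentZ σ 0,
      fun σ => (pinnedChain ω₂ lam β γ).energyDensityZ σ 0} : Set (ChainConfig → ℝ)),
      Measurable a ∧ DependsOn a (Icc (-1 : ℤ) 1) ∧ MemLp a 2 μ ∧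
      (∀ τ : ℝ, 0 ≤ τ → ∃ ε : ℕ → ℝ, (∀ n, 0 ≤ ε n) ∧ Summable ε ∧ ∀ t : ℝ, |t| ≤ τ → ∀ n : ℕ,
        ∃ g : ChainConfig → ℝ, DependsOn g (Icc (-(n : ℤ) - 1) (n + 1)) ∧ Measurable g ∧
          MemLp g 2 μ ∧ Real.sqrt (∫ σ, (a (D.flow t σ) - g σ) ^ 2 ∂μ) ≤ ε n) ∧
      ∀ x : ℤ, Continuous fun t : ℝ => ∫ σ, a σ * a (chainShift x (D.flow t σ)) ∂μ := by
    intro a ha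
    have hdata : Measurable a ∧ DependsOn a (Icc (-1 : ℤ) 1) ∧ MemLp a 2 μ ∧
        Integrable (fun σ => a σ ^ 4) μ ∧ (∃ (Ca : ℝ) (da : ℕ), 0 ≤ Ca ∧
          ∀ (σ σ' : ChainConfig) (R δ : ℝ), 1 ≤ R → 0 ≤ δ → δ ≤ 1 →
            (∀ i : ℤ, -1 ≤ i → i ≤ 1 → |(σ' i).1| ≤ R ∧ |(σ' i).2| ≤ R ∧
              |(σ i).1 - (σ' i).1| ≤ δ ∧ |(σ i).2 - (σ' i).2| ≤ δ) →
            |a σ - a σ'| ≤ Ca * R ^ da * δ) ∧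
        ∀ x : ℤ, Continuous fun t : ℝ => ∫ σ, a σ * a (chainShift x (D.flow t σ)) ∂μ := by
      rcases ha with rfl | rfl
      · obtain ⟨Ca, hCa, hL⟩ := OscillatorChain.exists_polyLipschitz_bondCurrentZ hV1
        refine ⟨measurable_bondCurrentZ _ 0, OscillatorChain.dependsOn_bondCurrentZ_zero _,
          hss.memLp_bondCurrentZ (by norm_num) hU0 hUm hV1 0 ENNReal.ofNat_ne_top,
          hpow4 (hss.memLp_bondCurrentZ (by norm_num) hU0 hUm hV1 0 ENNReal.ofNat_ne_top),
          ⟨Ca, 2 * 2 + 1, hCa, hL⟩, fun x => ?_⟩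
        simp only [OscillatorChain.bondCurrentZ_chainShift]
        exact D.continuous_integral_bondCurrentZ_mul_flow hss (by norm_num) hU0 hUm hV1 hD (0 + x) 0
      · obtain ⟨Ca, hCa, hL⟩ := OscillatorChain.exists_polyLipschitz_energyDensityZ hU1 hV1
        refine ⟨OscillatorChain.measurable_energyDensityZ _ hUm hVm 0,
          OscillatorChain.dependsOn_energyDensityZ_zero _,
          hss.memLp_energyDensityZ hU0 hV0 hUm hVm 0 ENNReal.ofNat_ne_top,
          hpow4 (hss.memLp_energyDensityZ hU0 hV0 hUm hVm 0 ENNReal.ofNat_ne_top),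
          ⟨Ca, 2 * 2 + 2 * 2 + 1, hCa, hL⟩, fun x => ?_⟩
        simp only [OscillatorChain.energyDensityZ_chainShift]
        exact D.continuous_integral_energyDensityZ_mul_flow hss hU0 hUc hV1 hD (0 + x) 0
    obtain ⟨ham, had, ha2, ha4, ⟨Ca, da, hCa, hL⟩, hcont⟩ := hdata
    refine ⟨ham, had, ha2, fun τ hτ0 => ?_, hcont⟩
    obtain ⟨ε, hε0, hε, hmain⟩ := D.exists_summable_l2_locality (by norm_num) (by norm_num) hU1 hV1
      hcar hB1 hss hD hsev ham had ha2 ha4 hCa hL τ hτ0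
    refine ⟨ε, hε0, hε, fun t ht n => ?_⟩
    obtain ⟨h1, h2, h3, h4⟩ := hmain t ht n
    exact ⟨_, h1, h2, h3, h4⟩
  refine ⟨μ, hG, hS, hss, hrefl, ?_, ?_⟩
  · -- summable space–time clustering of the pairs `a`, `(b ∘ τ_x) ∘ φ_u`
    intro a ha b hb u
    obtain ⟨ham, had, ha2, -, -⟩ := hgen a ha
    obtain ⟨hbm, -, hb2, hlocb, -⟩ := hgen b hb
    obtain ⟨ε, hε0, hε, happrox⟩ := hlocb |u| (abs_nonneg u)
    have hR : DependsOn a (Icc (-((1 : ℕ) : ℤ)) (1 : ℕ)) := by simpa using had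
    refine summable_covariance_comp_chainShift_comp hmix' hm hτ hR ham ha2 1 (hφ u)
      (hbm.comp (hmeas u)) (hb2.comp_measurePreserving (hD.2 u)) hε0 hε fun n => ?_
    obtain ⟨g, hgd, hgm, hg2, hge⟩ := happrox u le_rfl n
    refine ⟨g, hgd.mono fun i hi => ?_, hgm, hg2, hge⟩
    simp only [mem_Icc, Nat.cast_add, Nat.cast_one] at hi ⊢
    constructor <;> omega
  · -- continuity at `0` of the summed autocovariances
    intro a ha
    obtain ⟨ham, had, ha2, hloca, hconta⟩ := hgen a ha
    have hcj := D.continuous_integral_count_cov_flow hcar hid hU0 hV0 hτ hD hC hm hmix' ham had ha2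
      hloca hconta
    have hint : ∀ t : ℝ, Integrable (fun x : ℤ => cov[a, (a ∘ D.flow t) ∘ chainShift x; μ])
        (Measure.count : Measure ℤ) := by
      intro t
      obtain ⟨F, hF, hb⟩ := D.exists_summable_majorant_cov_flow hτ hD hC hm hmix' ham had ha2
        (hloca |t| (abs_nonneg t))
      rw [integrable_count_iff]
      refine Summable.of_nonneg_of_le (fun w => norm_nonneg _) (fun w => ?_) hF
      rw [Real.norm_eq_abs]
      exact hb t le_rfl w
    have e : (fun t : ℝ => ∑' x : ℤ, cov[a, (a ∘ chainShift x) ∘ D.flow t; μ]) =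
        fun t : ℝ => ∫ x, cov[a, (a ∘ D.flow t) ∘ chainShift x; μ] ∂(Measure.count : Measure ℤ) := by
      funext t
      rw [integral_countable (hint t)]
      simp only [count_real_singleton, one_smul]
      refine tsum_congr fun x => ?_
      rw [comp_chainShift_comp_eq (hφ t x)]
    rw [e]
    exact hcj.continuousAt

end Summit.AtomisticToContinuum.FouriersLaw.Theorems.MourreDissolution

end
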